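import Mathlib
import Summits.CriticalPhenomena.SAWScalingLimit.Theses.SAWDefectDecoherence
import Literature.Probability.RandomPlanarGeometry.HexParafermion
import Literature.Probability.RandomPlanarGeometry.HexSAW

/-!
# Sketch — crux-ideate stmt-CriticalPhenomena-8549 (DefectDecoherence), ideator 2, round 1

First lemmas of the two crux idea cards, stated over existing declarations only
(`hexParafermionicObservable`, `HexMidEdgeSAW.winding/.points/.length/.verts`, `hexCenter`,
`hexCriticalFugacity`, Mathlib `Polynomial.roots`, `Complex.arg`). Nothing here is proved; every
`def` is a `Prop` that must elaborate (`lean check` rc 0).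
-/

noncomputable section

namespace Summit.CriticalPhenomena.SAWScalingLimit.Cruxes.DefectDecoherence.Sketch

open Literature.Probability.RandomPlanarGeometry.SAW Literature.Probability.LatticeModels

/-! ## Card `winding-zero-sector` -/

/-- **First lemma (provable now; = DCS Lemma 1 restated by aliasing on the vertex star).**
On the star of `v` the six lattice directions are `e^{iθ_v} ω^k`, so the unit vector
`d_t = (m_t - c_v)/(ℓ/2)` satisfies `d_t = e^{3iθ_v} · conj(d_t)²` and
`conj(d_t)² = conj(d_a)² e^{-2iW}` walk by walk (`e^{iW}` = last increment / first increment).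
Hence `Σ_t (m_t - c_v) F_{5/8}(vt) = (ℓ/2) e^{3iθ_v} conj(d_a)² · Σ_t F_{21/8}(vt)`, and the
vertex relation is EXACTLY the vanishing of the plain star sum of the spin-`21/8` observable,
i.e. the winding generating Laurent polynomial `P_v(z) = Σ_γ x_c^ℓ z^{K(γ)}` has the exact
unit-circle zero pair `e^{±7πi/8}` for every simply connected `Λ`, boundary root and vertex. -/
def StarSumSpin21_8 : Prop :=
  ∀ (Λ : Finset HexVertex), hexDomainSimplyConnected Λ →
    ∀ (u w : HexVertex), hexGraph.Adj u w → u ∉ Λ → w ∈ Λ →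
      ∀ v ∈ Λ, (∀ t : HexVertex, hexGraph.Adj v t → t ∈ Λ) →
        ∑ t ∈ Λ.filter (fun t => hexGraph.Adj v t),
          hexParafermionicObservable Λ s(u, w) hexCriticalFugacity (21 / 8) s(v, t) = 0

/-- **Transfer lemma (pure Mathlib, provable now): the log-potential bound.** For a complex
polynomial `Q` with `Q(1) ≠ 0`, if every root `z` satisfies
`c·k(z) ≤ u_t(z)` with `k(z) := -Re(z/(1-z)²)` (so that `Σ_roots k = Var` of the coefficient law
when the coefficients are non-negative) and `u_t(z) := log|1-z| - log|e^{it}-z|`, then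
`|Q(e^{it})| ≤ exp(-c Σ_roots k(z)) |Q(1)|`. (Roots with multiplicity; `Q` splits over `ℂ`.)
With `t = 11π/24` this turns a zero-free region + a variance lower bound into the crux. -/
def ZeroSectorBound : Prop :=
  ∀ (Q : Polynomial ℂ) (t c : ℝ), Q.eval 1 ≠ 0 →
    (∀ z ∈ Q.roots, c * (-(z / (1 - z) ^ 2)).re ≤
        Real.log ‖1 - z‖ - Real.log ‖Complex.exp (t * Complex.I) - z‖) →
      ‖Q.eval (Complex.exp (t * Complex.I))‖ ≤
        Real.exp (-(c * (Q.roots.map fun z => (-(z / (1 - z) ^ 2)).re).sum)) * ‖Q.eval 1‖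

/-- **Crux-side input 1 (open): a zero-free region for the winding polynomial.** In log
coordinates `z = e^ζ`, the exponential sum `Σ_t Σ_γ x_c^ℓ e^{ζ·3W_γ/π}` (`= e^{-ζ k_a} P_v(e^ζ)`,
same zeros as `P_v`) does not vanish in the region `Bad(t,c) = {z : u_t(z) < c k(z)}`,
`t = 11π/24`, for every simply connected `Λ`, boundary root, and `R`-deep `v`, `R ≥ R₀`. -/
def WindingZeroFreeRegion (c R₀ : ℝ) : Prop :=
  ∀ (Λ : Finset HexVertex), hexDomainSimplyConnected Λ →
    ∀ (u w : HexVertex), hexGraph.Adj u w → u ∉ Λ → w ∈ Λ →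
      ∀ (v : HexVertex) (R : ℝ), R₀ ≤ R →
        (∀ y : HexVertex, dist (hexCenter y) (hexCenter v) ≤ R → y ∈ Λ) →
          ∀ ζ : ℂ,
            Real.log ‖1 - Complex.exp ζ‖ -
                Real.log ‖Complex.exp ((11 * Real.pi / 24 : ℝ) * Complex.I) - Complex.exp ζ‖ <
              c * (-(Complex.exp ζ / (1 - Complex.exp ζ) ^ 2)).re →
            (∑ t ∈ Λ.filter (fun t => hexGraph.Adj v t),
                ∑ γ : HexMidEdgeSAW Λ s(u, w) s(v, t),
                  (hexCriticalFugacity : ℂ) ^ γ.length *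
                    Complex.exp (ζ * ((3 * γ.winding / Real.pi : ℝ) : ℂ))) ≠ 0

/-- **Crux-side input 2 (open, positive-measure): logarithmic winding variance at deep
vertices** — under the `x_c^ℓ`-weighted law on walks from the boundary root to the star of an
`R`-deep vertex, `Var(W) ≥ c log R`. (Duplantier–Saleur / Coulomb gas predict `(8/3) log R`;
the transfer needs only `c > 3π²/(36·0.87) ≈ 0.95`.) -/
def WindingVarianceLowerBound (c R₀ : ℝ) : Prop :=
  ∀ (Λ : Finset HexVertex), hexDomainSimplyConnected Λ →
    ∀ (u w : HexVertex), hexGraph.Adj u w → u ∉ Λ → w ∈ Λ →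
      ∀ (v : HexVertex) (R : ℝ), R₀ ≤ R →
        (∀ y : HexVertex, dist (hexCenter y) (hexCenter v) ≤ R → y ∈ Λ) →
          c * Real.log R ≤
            (∑ t ∈ Λ.filter (fun t => hexGraph.Adj v t),
                ∑ γ : HexMidEdgeSAW Λ s(u, w) s(v, t), hexCriticalFugacity ^ γ.length * γ.winding ^ 2) /
              (∑ t ∈ Λ.filter (fun t => hexGraph.Adj v t),
                ∑ γ : HexMidEdgeSAW Λ s(u, w) s(v, t), hexCriticalFugacity ^ γ.length) -
            ((∑ t ∈ Λ.filter (fun t => hexGraph.Adj v t),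
                ∑ γ : HexMidEdgeSAW Λ s(u, w) s(v, t), hexCriticalFugacity ^ γ.length * γ.winding) /
              (∑ t ∈ Λ.filter (fun t => hexGraph.Adj v t),
                ∑ γ : HexMidEdgeSAW Λ s(u, w) s(v, t), hexCriticalFugacity ^ γ.length)) ^ 2

/-- **Transfer statement of the card** (the route's crux by name on the right). -/
def ZeroSectorTransfer : Prop :=
  ∃ c R₀ cW : ℝ, 3 / 4 < 9 * c * cW / Real.pi ^ 2 ∧
    WindingZeroFreeRegion c R₀ ∧ WindingVarianceLowerBound cW R₀ ∧
    (WindingZeroFreeRegion c R₀ → WindingVarianceLowerBound cW R₀ →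
      Summit.CriticalPhenomena.SAWScalingLimit.Theses.SAWDefectDecoherence.DefectDecoherence)

/-! ## Card `endpoint-umlaufsatz-lastexit` -/

/-- The polar angle swept about the vertex `v` along the embedded polyline of a walk
(consecutive points subtend `≤ π/3 < π` at `c_v` when the walk avoids `v`, so the `arg` of each
ratio is the correct lift). Stated inline below; named here only for readability. -/
def sweptAngle (v : HexVertex) (pts : List ℂ) : ℝ :=
  ((pts.zip pts.tail).map fun pq => Complex.arg ((pq.2 - hexCenter v) / (pq.1 - hexCenter v))).sum

/-- **First lemma (the endpoint Umlaufsatz; new, provable with the tree's `Hopf.hopf_open` /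
`HV.hopf_path` + an exterior-path argument).** For walks from a BOUNDARY mid-edge of a simply
connected domain to a mid-edge of the star of `v` that do not visit `v`, the winding equals the
polar angle swept about `c_v` up to a constant depending only on `(Λ, a, v, t)`:
`W(γ) - sweep_v(γ) = W(γ') - sweep_v(γ')`. Consequence: the parafermionic phase at the tip is
the characteristic function of the swept polar angle — tangent-free and exactly additive under
ANY time decomposition of the walk (no screens, no single-crossing requirement). -/
def EndpointUmlaufsatz : Prop :=
  ∀ (Λ : Finset HexVertex), hexDomainSimplyConnected Λ →
    ∀ a ∈ hexDomainBoundary Λ, ∀ (v t : HexVertex), hexGraph.Adj v t →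
      ∀ γ γ' : HexMidEdgeSAW Λ a s(v, t), v ∉ γ.verts → v ∉ γ'.verts →
        γ.winding - sweptAngle v γ.points = γ'.winding - sweptAngle v γ'.points

/-- The same statement with the swept angle written out (no auxiliary definition). -/
def EndpointUmlaufsatz' : Prop :=
  ∀ (Λ : Finset HexVertex), hexDomainSimplyConnected Λ →
    ∀ a ∈ hexDomainBoundary Λ, ∀ (v t : HexVertex), hexGraph.Adj v t →
      ∀ γ γ' : HexMidEdgeSAW Λ a s(v, t), v ∉ γ.verts → v ∉ γ'.verts →
        γ.winding -
            ((γ.points.zip γ.points.tail).map fun pq =>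
                Complex.arg ((pq.2 - hexCenter v) / (pq.1 - hexCenter v))).sum =
          γ'.winding -
            ((γ'.points.zip γ'.points.tail).map fun pq =>
                Complex.arg ((pq.2 - hexCenter v) / (pq.1 - hexCenter v))).sum

/-- **Second checkable statement of the line (provable now; the exploration / domain-Markov
step the last-exit decomposition iterates).** First-step decomposition of the observable with
its phase: for `z ≠ a = {u,w}`,
`F^{Λ,a}_σ(z) = x · Σ_{w' ∼ w, w' ∈ Λ} e^{-iσ·turn(mid a, c_w, c_{w'})} F^{Λ∖{w}, {w,w'}}_σ(z)`. -/
def ExplorationStep : Prop :=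
  ∀ (Λ : Finset HexVertex) (u w : HexVertex) (x σ : ℝ) (z : Sym2 HexVertex),
    hexGraph.Adj u w → u ∉ Λ → w ∈ Λ → z ≠ s(u, w) →
      hexParafermionicObservable Λ s(u, w) x σ z =
        (x : ℂ) * ∑ w' ∈ Λ.filter (fun w' => hexGraph.Adj w w'),
          Complex.exp (-Complex.I * σ *
              (turning (hexMidpoint s(u, w)) (hexCenter w) (hexCenter w') : ℝ)) *
            hexParafermionicObservable (Λ.erase w) s(w, w') x σ z

end Summit.CriticalPhenomena.SAWScalingLimit.Cruxes.DefectDecoherence.Sketch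

end
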